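import Mathlib
import Summits.Parity.GeneralizedHardyLittlewood.Theses.LiouvilleMAD

/-!
# `stub_calibrationL1`: what the crux `CosetDecorrelation` contains — a power-saving,
fixed-residue Bombieri–Vinogradov statement for `λ` at level `1/2`

Line `SketchIdeator3` of the crux stmt-Parity-13317
(`Summit.Parity.GeneralizedHardyLittlewood.Theses.LiouvilleMAD.CosetDecorrelation`), card
`farey-level-mean-coupling`; port of the kernel-checked `calibrationL1Raw_of_cosetDecorrelation`
of `Cruxes/CosetDecorrelation/SketchIdeator3.lean`, def-free; Mathlib + the route file only.

**Statement.** `CosetDecorrelation ⇒ ∀ c ≠ 0, ∃ κ > 0, ∃ C', ∀ N ≤ 2M,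
Σ_{n≤N} |Σ_{m∈(M,2M]} λ(mn+c)| ≤ C'·(M√N + N·M^{3/4−κ/2})` (`stub_calibrationL1`), and the plain
corollary for `|Σ_{n≤N} Σ_{m∈(M,2M]} λ(mn+c)|` (`calibration_tableMean`).

**Proof.** With `A_n(a) = Σ_{m∈(M,2M], m≡a (j)} λ(mn+c)`, the coset sum of the crux is the class inner
product `T_j(n,n') = Σ_{a<j} A_n(a)A_{n'}(a)` and `S(n) = Σ_a A_n(a) = Σ_{m∈(M,2M]} λ(mn+c)`.
Positivity amplifier with sign weights `w_n = sgn S(n)`: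
`(Σ_{n≤N} |S(n)|)² = (Σ_n w_n S(n))² ≤ j Σ_{n,n'≤N} w_n w_{n'} T_j(n,n')` (Cauchy–Schwarz over the `j`
classes); the `N` diagonal terms are `≤ (2M/j+1)·M` trivially and the `N(N−1)` off-diagonal ones are
bounded by the crux at `j = ⌊√M⌋+1` (`calibration_raw`, general weights bounded by `1`).  Numerics
(`calibration_numerics`): `⌊√M⌋+1 ≤ 2√M`, `2M/(⌊√M⌋+1) ≤ 2√M`, so
`(Σ|S|)² ≤ 6NM² + 2C⁺N²M^{5/4+ϑ} = a² + b²` with `a = √6·M·√N`, `b = √(2C⁺)·N·M^{5/8+ϑ/2}`, hence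
`Σ|S| ≤ a + b ≤ (√6 + √(2C⁺))·(M√N + N·M^{3/4−κ/2})` with `κ = 1/4 − ϑ > 0`; `N = 0` is trivial.
-/

namespace Summit.Parity.GeneralizedHardyLittlewood.Theorems.CosetDecorrelation.FareyLevelMeanCoupling

open Finset
open Summit.Parity.GeneralizedHardyLittlewood.Theses.LiouvilleMAD (CosetDecorrelation)

/-- For `a < j` the class filter `m ≡ a (mod j)` is the fibre of `m ↦ m % j` over `a`. -/
private theorem calibration_filter_modEq (S : Finset ℕ) {j a : ℕ} (ha : a < j) :
    S.filter (fun m => m ≡ a [MOD j]) = S.filter (fun m => m % j = a) := by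
  have ha' : a % j = a := Nat.mod_eq_of_lt ha
  ext m
  simp only [mem_filter, Nat.ModEq, ha']

/-- The classes `a < j` partition `S`: `Σ_{a<j} Σ_{m∈S, m≡a (j)} f(m) = Σ_{m∈S} f(m)`. -/
private theorem calibration_sum_class (f : ℕ → ℝ) (S : Finset ℕ) {j : ℕ} (hj : 1 ≤ j) :
    ∑ a ∈ range j, ∑ m ∈ S.filter (fun m => m ≡ a [MOD j]), f m = ∑ m ∈ S, f m := by
  rw [sum_congr rfl fun a ha => by rw [calibration_filter_modEq S (mem_range.mp ha)]]
  exact sum_fiberwise_of_maps_to (fun m _ => mem_range.mpr (Nat.mod_lt _ hj)) _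

/-- CLASS INNER PRODUCT: `Σ_{(m,m')∈S², m≡m' (j)} f(m)g(m') = Σ_{a<j} (Σ_{m≡a} f)(Σ_{m≡a} g)`
(fibre the pair set by the common class `m % j`). -/
private theorem calibration_classInner (f g : ℕ → ℝ) (S : Finset ℕ) {j : ℕ} (hj : 1 ≤ j) :
    ∑ p ∈ (S ×ˢ S).filter (fun p : ℕ × ℕ => p.1 ≡ p.2 [MOD j]), f p.1 * g p.2 =
      ∑ a ∈ range j, (∑ m ∈ S.filter (fun m => m ≡ a [MOD j]), f m) *
        (∑ m ∈ S.filter (fun m => m ≡ a [MOD j]), g m) := by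
  have key : ∀ a ∈ range j,
      (S.filter (fun m => m ≡ a [MOD j])) ×ˢ (S.filter (fun m => m ≡ a [MOD j])) =
        ((S ×ˢ S).filter (fun p : ℕ × ℕ => p.1 ≡ p.2 [MOD j])).filter
          (fun p : ℕ × ℕ => p.1 % j = a) := by
    intro a ha
    have ha' : a % j = a := Nat.mod_eq_of_lt (mem_range.mp ha)
    ext ⟨m, m'⟩
    simp only [mem_product, mem_filter, Nat.ModEq]
    constructor
    · rintro ⟨⟨hm, hma⟩, ⟨hm', hm'a⟩⟩
      exact ⟨⟨⟨hm, hm'⟩, by rw [hma, hm'a]⟩, by rw [hma, ha']⟩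
    · rintro ⟨⟨⟨hm, hm'⟩, hmm'⟩, hma⟩
      exact ⟨⟨hm, by rw [hma, ha']⟩, ⟨hm', by rw [← hmm', hma, ha']⟩⟩
  symm
  calc ∑ a ∈ range j, (∑ m ∈ S.filter (fun m => m ≡ a [MOD j]), f m) *
          (∑ m ∈ S.filter (fun m => m ≡ a [MOD j]), g m)
      = ∑ a ∈ range j, ∑ p ∈ (S.filter (fun m => m ≡ a [MOD j])) ×ˢ
            (S.filter (fun m => m ≡ a [MOD j])), f p.1 * g p.2 := by
          refine sum_congr rfl fun a _ => ?_
          rw [sum_mul_sum, ← sum_product']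
    _ = ∑ a ∈ range j, ∑ p ∈ ((S ×ˢ S).filter (fun p : ℕ × ℕ => p.1 ≡ p.2 [MOD j])).filter
            (fun p : ℕ × ℕ => p.1 % j = a), f p.1 * g p.2 :=
          sum_congr rfl fun a ha => by rw [key a ha]
    _ = _ := sum_fiberwise_of_maps_to (fun p _ => mem_range.mpr (Nat.mod_lt _ hj)) _

/-- POSITIVITY AMPLIFIER: for profiles `A n : ℕ → ℝ` on `ℤ/j` and a finite set of rows `𝒩`,
`(Σ_{n∈𝒩} Σ_{a<j} A n a)² ≤ j · Σ_{n,n'∈𝒩} Σ_{a<j} A n a · A n' a` (Cauchy–Schwarz over the classes). -/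
private theorem calibration_amplifier (A : ℕ → ℕ → ℝ) (𝒩 : Finset ℕ) (j : ℕ) :
    (∑ n ∈ 𝒩, ∑ a ∈ range j, A n a) ^ 2 ≤
      (j : ℝ) * ∑ n ∈ 𝒩, ∑ n' ∈ 𝒩, ∑ a ∈ range j, A n a * A n' a := by
  have h1 : ∑ n ∈ 𝒩, ∑ n' ∈ 𝒩, ∑ a ∈ range j, A n a * A n' a =
      ∑ a ∈ range j, (∑ n ∈ 𝒩, A n a) ^ 2 := by
    symm
    calc ∑ a ∈ range j, (∑ n ∈ 𝒩, A n a) ^ 2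
        = ∑ a ∈ range j, ∑ n ∈ 𝒩, ∑ n' ∈ 𝒩, A n a * A n' a :=
          sum_congr rfl fun a _ => by rw [sq, sum_mul_sum]
      _ = ∑ n ∈ 𝒩, ∑ a ∈ range j, ∑ n' ∈ 𝒩, A n a * A n' a := sum_comm
      _ = ∑ n ∈ 𝒩, ∑ n' ∈ 𝒩, ∑ a ∈ range j, A n a * A n' a :=
          sum_congr rfl fun n _ => sum_comm
  have h2 : ∑ n ∈ 𝒩, ∑ a ∈ range j, A n a = ∑ a ∈ range j, 1 * ∑ n ∈ 𝒩, A n a := by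
    rw [sum_comm]
    simp
  rw [h1, h2]
  calc (∑ a ∈ range j, 1 * ∑ n ∈ 𝒩, A n a) ^ 2
      ≤ (∑ a ∈ range j, (1 : ℝ) ^ 2) * ∑ a ∈ range j, (∑ n ∈ 𝒩, A n a) ^ 2 :=
        sum_mul_sq_le_sq_mul_sq _ _ _
    _ = (j : ℝ) * ∑ a ∈ range j, (∑ n ∈ 𝒩, A n a) ^ 2 := by simp

/-- WEIGHTED GRAM BOUND: `(Σ_{n∈𝒩} w_n Σ_{m∈S} F n m)² ≤ j · Σ_{n,n'∈𝒩} w_n w_{n'} T_j(n,n')`, where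
`T_j(n,n') = Σ_{(m,m')∈S², m≡m' (j)} F n m · F n' m'` (amplifier + class inner product). -/
private theorem calibration_gram (F : ℕ → ℕ → ℝ) (w : ℕ → ℝ) (S 𝒩 : Finset ℕ) {j : ℕ} (hj : 1 ≤ j) :
    (∑ n ∈ 𝒩, w n * ∑ m ∈ S, F n m) ^ 2 ≤
      (j : ℝ) * ∑ n ∈ 𝒩, ∑ n' ∈ 𝒩, w n * w n' *
        ∑ p ∈ (S ×ˢ S).filter (fun p : ℕ × ℕ => p.1 ≡ p.2 [MOD j]), F n p.1 * F n' p.2 := by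
  have h := calibration_amplifier
    (fun n a => w n * ∑ m ∈ S.filter (fun m => m ≡ a [MOD j]), F n m) 𝒩 j
  have e1 : ∀ n, ∑ a ∈ range j, w n * ∑ m ∈ S.filter (fun m => m ≡ a [MOD j]), F n m =
      w n * ∑ m ∈ S, F n m := by
    intro n
    rw [← mul_sum, calibration_sum_class (F n) S hj]
  have e2 : ∀ n n', ∑ a ∈ range j, (w n * ∑ m ∈ S.filter (fun m => m ≡ a [MOD j]), F n m) *
      (w n' * ∑ m ∈ S.filter (fun m => m ≡ a [MOD j]), F n' m) =
      w n * w n' *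
        ∑ p ∈ (S ×ˢ S).filter (fun p : ℕ × ℕ => p.1 ≡ p.2 [MOD j]), F n p.1 * F n' p.2 := by
    intro n n'
    rw [calibration_classInner (F n) (F n') S hj, mul_sum]
    exact sum_congr rfl fun a _ => by ring
  simp only [e1, e2] at h
  exact h

/-- Each class of `(M,2M]` modulo `j ≥ 1` has at most `2M/j + 1` elements (inject by `m ↦ m / j`). -/
private theorem calibration_card_class_le (M a : ℕ) {j : ℕ} (_hj : 1 ≤ j) :
    (((Ioc M (2 * M)).filter (fun m => m ≡ a [MOD j])).card : ℝ) ≤ 2 * (M : ℝ) / j + 1 := by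
  have hinj : Set.InjOn (fun m => m / j)
      (((Ioc M (2 * M)).filter (fun m => m ≡ a [MOD j]) : Finset ℕ) : Set ℕ) := by
    intro m hm m' hm' h
    rw [mem_coe, mem_filter] at hm hm'
    have hmod : m % j = m' % j := hm.2.trans hm'.2.symm
    have h' : m / j = m' / j := h
    calc m = j * (m / j) + m % j := (Nat.div_add_mod m j).symm
      _ = j * (m' / j) + m' % j := by rw [h', hmod]
      _ = m' := Nat.div_add_mod m' j
  have hmaps : Set.MapsTo (fun m => m / j)
      (((Ioc M (2 * M)).filter (fun m => m ≡ a [MOD j]) : Finset ℕ) : Set ℕ)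
      ((range (2 * M / j + 1) : Finset ℕ) : Set ℕ) := by
    intro m hm
    rw [mem_coe, mem_filter, mem_Ioc] at hm
    rw [mem_coe, mem_range]
    exact Nat.lt_succ_of_le (Nat.div_le_div_right hm.1.2)
  have hcard := card_le_card_of_injOn (fun m => m / j) hmaps hinj
  rw [card_range] at hcard
  have hdiv : ((2 * M / j : ℕ) : ℝ) ≤ 2 * (M : ℝ) / j := by
    have := Nat.cast_div_le (m := 2 * M) (n := j) (α := ℝ)
    push_cast at this
    exact this
  calc (((Ioc M (2 * M)).filter (fun m => m ≡ a [MOD j])).card : ℝ)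
      ≤ ((2 * M / j + 1 : ℕ) : ℝ) := by exact_mod_cast hcard
    _ = ((2 * M / j : ℕ) : ℝ) + 1 := by push_cast; ring
    _ ≤ 2 * (M : ℝ) / j + 1 := by linarith

/-- The classes partition `(M,2M]`: `Σ_{a<j} #{m ∈ (M,2M] : m ≡ a (j)} = M`. -/
private theorem calibration_sum_card_class (M : ℕ) {j : ℕ} (hj : 1 ≤ j) :
    ∑ a ∈ range j, (((Ioc M (2 * M)).filter (fun m => m ≡ a [MOD j])).card : ℝ) = M := by
  have h := card_eq_sum_card_fiberwise (f := fun m => m % j) (s := Ioc M (2 * M)) (t := range j)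
    (fun m _ => mem_range.mpr (Nat.mod_lt _ hj))
  rw [Nat.card_Ioc] at h
  have h3 : (∑ a ∈ range j, ((Ioc M (2 * M)).filter (fun m => m ≡ a [MOD j])).card : ℕ) = M := by
    rw [sum_congr rfl fun a ha => by rw [calibration_filter_modEq _ (mem_range.mp ha)], ← h]
    omega
  exact_mod_cast h3

/-- TRIVIAL BOUND: for weights bounded by `1`, `|T_j| ≤ (2M/j + 1)·M` (via the class inner product,
`|Σ_{m≡a} f| ≤ #class_a ≤ 2M/j + 1` and `Σ_a #class_a = M`). -/
private theorem calibration_abs_coset_le (f g : ℕ → ℝ) (hf : ∀ m, |f m| ≤ 1) (hg : ∀ m, |g m| ≤ 1)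
    (M : ℕ) {j : ℕ} (hj : 1 ≤ j) :
    |∑ p ∈ (Ioc M (2 * M) ×ˢ Ioc M (2 * M)).filter (fun p : ℕ × ℕ => p.1 ≡ p.2 [MOD j]),
        f p.1 * g p.2| ≤ (2 * (M : ℝ) / j + 1) * M := by
  rw [calibration_classInner f g _ hj]
  have hA : ∀ h : ℕ → ℝ, (∀ m, |h m| ≤ 1) → ∀ a,
      |∑ m ∈ (Ioc M (2 * M)).filter (fun m => m ≡ a [MOD j]), h m| ≤
        (((Ioc M (2 * M)).filter (fun m => m ≡ a [MOD j])).card : ℝ) := by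
    intro h hh a
    calc |∑ m ∈ (Ioc M (2 * M)).filter (fun m => m ≡ a [MOD j]), h m|
        ≤ ∑ m ∈ (Ioc M (2 * M)).filter (fun m => m ≡ a [MOD j]), |h m| := abs_sum_le_sum_abs _ _
      _ ≤ ∑ m ∈ (Ioc M (2 * M)).filter (fun m => m ≡ a [MOD j]), (1 : ℝ) :=
          sum_le_sum fun m _ => hh m
      _ = _ := by simp
  calc |∑ a ∈ range j, (∑ m ∈ (Ioc M (2 * M)).filter (fun m => m ≡ a [MOD j]), f m) *
          (∑ m ∈ (Ioc M (2 * M)).filter (fun m => m ≡ a [MOD j]), g m)|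
      ≤ ∑ a ∈ range j, |(∑ m ∈ (Ioc M (2 * M)).filter (fun m => m ≡ a [MOD j]), f m) *
          (∑ m ∈ (Ioc M (2 * M)).filter (fun m => m ≡ a [MOD j]), g m)| := abs_sum_le_sum_abs _ _
    _ ≤ ∑ a ∈ range j, (2 * (M : ℝ) / j + 1) *
          (((Ioc M (2 * M)).filter (fun m => m ≡ a [MOD j])).card : ℝ) := by
        refine sum_le_sum fun a _ => ?_
        rw [abs_mul]
        calc |∑ m ∈ (Ioc M (2 * M)).filter (fun m => m ≡ a [MOD j]), f m| *
              |∑ m ∈ (Ioc M (2 * M)).filter (fun m => m ≡ a [MOD j]), g m|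
            ≤ (((Ioc M (2 * M)).filter (fun m => m ≡ a [MOD j])).card : ℝ) *
                (((Ioc M (2 * M)).filter (fun m => m ≡ a [MOD j])).card : ℝ) :=
              mul_le_mul (hA f hf a) (hA g hg a) (abs_nonneg _) (Nat.cast_nonneg _)
          _ ≤ (2 * (M : ℝ) / j + 1) *
                (((Ioc M (2 * M)).filter (fun m => m ≡ a [MOD j])).card : ℝ) :=
              mul_le_mul_of_nonneg_right (calibration_card_class_le M a hj) (Nat.cast_nonneg _)
    _ = (2 * (M : ℝ) / j + 1) * M := by rw [← mul_sum, calibration_sum_card_class M hj]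

/-- RAW ℓ¹ CALIBRATION (general rows `F n` bounded by `1`, modulus `j ≥ 1`): if every off-diagonal
coset sum `T_j(n,n')`, `n ≠ n' ∈ [1,N]`, is at most `E ≥ 0`, then
`(Σ_{n≤N} |Σ_{m∈(M,2M]} F n m|)² ≤ j·(N·(2M/j+1)·M + N²·E)` (sign-weighted amplifier). -/
private theorem calibration_raw (F : ℕ → ℕ → ℝ) (hF : ∀ n m, |F n m| ≤ 1) (M N : ℕ) {j : ℕ}
    (hj : 1 ≤ j) {E : ℝ} (hE : 0 ≤ E)
    (hT : ∀ n ∈ Icc 1 N, ∀ n' ∈ Icc 1 N, n ≠ n' →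
      |∑ p ∈ (Ioc M (2 * M) ×ˢ Ioc M (2 * M)).filter (fun p : ℕ × ℕ => p.1 ≡ p.2 [MOD j]),
          F n p.1 * F n' p.2| ≤ E) :
    (∑ n ∈ Icc 1 N, |∑ m ∈ Ioc M (2 * M), F n m|) ^ 2 ≤
      (j : ℝ) * ((N : ℝ) * ((2 * (M : ℝ) / j + 1) * M) + (N : ℝ) ^ 2 * E) := by
  set w : ℕ → ℝ := fun n => if 0 ≤ ∑ m ∈ Ioc M (2 * M), F n m then 1 else -1 with hwdef
  have hw : ∀ n, w n * ∑ m ∈ Ioc M (2 * M), F n m = |∑ m ∈ Ioc M (2 * M), F n m| := by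
    intro n
    simp only [hwdef]
    split_ifs with h
    · rw [one_mul, abs_of_nonneg h]
    · rw [neg_one_mul, abs_of_neg (lt_of_not_ge h)]
  have hwabs : ∀ n, |w n| = 1 := by
    intro n
    simp only [hwdef]
    split_ifs <;> simp
  have hww : ∀ n n' (x : ℝ), w n * w n' * x ≤ |x| := by
    intro n n' x
    calc w n * w n' * x ≤ |w n * w n' * x| := le_abs_self _
      _ = |x| := by rw [abs_mul, abs_mul, hwabs, hwabs, one_mul, one_mul]
  have hsq : (∑ n ∈ Icc 1 N, |∑ m ∈ Ioc M (2 * M), F n m|) ^ 2 =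
      (∑ n ∈ Icc 1 N, w n * ∑ m ∈ Ioc M (2 * M), F n m) ^ 2 := by
    rw [sum_congr rfl fun n _ => (hw n).symm]
  rw [hsq]
  refine (calibration_gram F w (Ioc M (2 * M)) (Icc 1 N) hj).trans ?_
  refine mul_le_mul_of_nonneg_left ?_ (Nat.cast_nonneg _)
  set D : ℝ := (2 * (M : ℝ) / j + 1) * M with hDdef
  have hterm : ∀ n ∈ Icc 1 N, ∀ n' ∈ Icc 1 N,
      w n * w n' * ∑ p ∈ (Ioc M (2 * M) ×ˢ Ioc M (2 * M)).filter
          (fun p : ℕ × ℕ => p.1 ≡ p.2 [MOD j]), F n p.1 * F n' p.2 ≤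
        D * (if n = n' then 1 else 0) + E := by
    intro n hn n' hn'
    refine (hww n n' _).trans ?_
    split_ifs with h
    · rw [mul_one]
      have := calibration_abs_coset_le (F n) (F n') (hF n) (hF n') M hj
      linarith
    · rw [mul_zero, zero_add]
      exact hT n hn n' hn' h
  have hinner : ∀ n ∈ Icc 1 N,
      ∑ n' ∈ Icc 1 N, (D * (if n = n' then (1 : ℝ) else 0) + E) = D + (N : ℝ) * E := by
    intro n hn
    rw [sum_add_distrib, ← mul_sum, sum_ite_eq, if_pos hn, sum_const, Nat.card_Icc, nsmul_eq_mul,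
      mul_one, Nat.add_sub_cancel]
  calc ∑ n ∈ Icc 1 N, ∑ n' ∈ Icc 1 N, w n * w n' *
          ∑ p ∈ (Ioc M (2 * M) ×ˢ Ioc M (2 * M)).filter (fun p : ℕ × ℕ => p.1 ≡ p.2 [MOD j]),
            F n p.1 * F n' p.2
      ≤ ∑ n ∈ Icc 1 N, ∑ n' ∈ Icc 1 N, (D * (if n = n' then (1 : ℝ) else 0) + E) :=
        sum_le_sum fun n hn => sum_le_sum fun n' hn' => hterm n hn n' hn'
    _ = ∑ n ∈ Icc 1 N, (D + (N : ℝ) * E) := sum_congr rfl hinner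
    _ = (N : ℝ) * D + (N : ℝ) ^ 2 * E := by
        rw [sum_const, Nat.card_Icc, nsmul_eq_mul]
        push_cast
        ring

/-- NUMERICS: from the raw bound at `j = ⌊√M⌋+1` (`M ≥ 1`, `C ≥ 0`) to the clean one:
`⌊√M⌋+1 ≤ 2√M` and `2M/(⌊√M⌋+1) ≤ 2√M` give `X² ≤ 6NM² + 2CN²M^{5/4+ϑ} = a² + b²` with
`a = √6·M·√N`, `b = √(2C)·N·M^{3/4−(1/4−ϑ)/2}`, hence `X ≤ a + b ≤ (√6 + √(2C))·(M√N + N·M^{3/4−(1/4−ϑ)/2})`. -/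
private theorem calibration_numerics {X C ϑ : ℝ} {M N : ℕ} (hM : 1 ≤ M) (hC : 0 ≤ C)
    (h : X ^ 2 ≤ ((Nat.sqrt M + 1 : ℕ) : ℝ) *
      ((N : ℝ) * ((2 * (M : ℝ) / ((Nat.sqrt M + 1 : ℕ) : ℝ) + 1) * M) +
        (N : ℝ) ^ 2 * (C * (M : ℝ) ^ (3 / 4 + ϑ)))) :
    X ≤ (Real.sqrt 6 + Real.sqrt (2 * C)) *
      ((M : ℝ) * Real.sqrt N + (N : ℝ) * (M : ℝ) ^ (3 / 4 - (1 / 4 - ϑ) / 2)) := by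
  set s : ℝ := Real.sqrt M with hs
  set jr : ℝ := ((Nat.sqrt M + 1 : ℕ) : ℝ) with hjr
  set P : ℝ := (M : ℝ) ^ (3 / 4 + ϑ) with hP
  set Q : ℝ := (M : ℝ) ^ (3 / 4 - (1 / 4 - ϑ) / 2) with hQ
  have hMr : (1 : ℝ) ≤ M := by exact_mod_cast hM
  have hMpos : (0 : ℝ) < M := by linarith
  have hNr : (0 : ℝ) ≤ N := Nat.cast_nonneg _
  have hs1 : 1 ≤ s := Real.one_le_sqrt.mpr hMr
  have hss : s * s = M := Real.mul_self_sqrt hMpos.le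
  have hjs : s < jr := by
    have := Real.real_sqrt_lt_nat_sqrt_succ (a := M)
    rw [hjr]; push_cast; exact this
  have hjle : jr ≤ s + 1 := by
    have := Real.nat_sqrt_le_real_sqrt (a := M)
    rw [hjr]; push_cast; linarith
  have hj2s : jr ≤ 2 * s := by linarith
  have hjpos : 0 < jr := by linarith
  have hdiv : 2 * (M : ℝ) / jr ≤ 2 * s := by
    rw [div_le_iff₀ hjpos]; nlinarith
  have hD : (2 * (M : ℝ) / jr + 1) * M ≤ 3 * s * M := by nlinarith
  have hP0 : 0 ≤ P := Real.rpow_nonneg hMpos.le _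
  have hQ0 : 0 ≤ Q := Real.rpow_nonneg hMpos.le _
  have hsP : s * P = Q * Q := by
    rw [hs, hP, hQ, Real.sqrt_eq_rpow, ← Real.rpow_add hMpos, ← Real.rpow_add hMpos]
    congr 1
    ring
  have h1 : X ^ 2 ≤ 6 * N * M * M + 2 * C * (N : ℝ) ^ 2 * (Q * Q) := by
    have hin : (N : ℝ) * ((2 * (M : ℝ) / jr + 1) * M) + (N : ℝ) ^ 2 * (C * P) ≤
        N * (3 * s * M) + (N : ℝ) ^ 2 * (C * P) := by
      have := mul_le_mul_of_nonneg_left hD hNr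
      linarith
    have hin0 : 0 ≤ (N : ℝ) * (3 * s * M) + (N : ℝ) ^ 2 * (C * P) := by positivity
    calc X ^ 2 ≤ jr * ((N : ℝ) * ((2 * (M : ℝ) / jr + 1) * M) + (N : ℝ) ^ 2 * (C * P)) := h
      _ ≤ jr * (N * (3 * s * M) + (N : ℝ) ^ 2 * (C * P)) := mul_le_mul_of_nonneg_left hin hjpos.le
      _ ≤ (2 * s) * (N * (3 * s * M) + (N : ℝ) ^ 2 * (C * P)) :=
          mul_le_mul_of_nonneg_right hj2s hin0
      _ = 6 * N * (s * s) * M + 2 * C * (N : ℝ) ^ 2 * (s * P) := by ring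
      _ = 6 * N * M * M + 2 * C * (N : ℝ) ^ 2 * (Q * Q) := by rw [hss, hsP]
  have h6 : Real.sqrt 6 ^ 2 = 6 := Real.sq_sqrt (by norm_num)
  have h2C : Real.sqrt (2 * C) ^ 2 = 2 * C := Real.sq_sqrt (by positivity)
  have hN2 : Real.sqrt N ^ 2 = N := Real.sq_sqrt hNr
  have hab : 0 ≤ Real.sqrt 6 * ((M : ℝ) * Real.sqrt N) * (Real.sqrt (2 * C) * ((N : ℝ) * Q)) := by
    positivity
  have h2 : X ^ 2 ≤ (Real.sqrt 6 * ((M : ℝ) * Real.sqrt N) + Real.sqrt (2 * C) * ((N : ℝ) * Q)) ^ 2 :=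
    calc X ^ 2 ≤ 6 * N * M * M + 2 * C * (N : ℝ) ^ 2 * (Q * Q) := h1
      _ = (Real.sqrt 6 * ((M : ℝ) * Real.sqrt N)) ^ 2 + (Real.sqrt (2 * C) * ((N : ℝ) * Q)) ^ 2 := by
          rw [mul_pow, mul_pow, mul_pow, mul_pow, h6, h2C, hN2]; ring
      _ ≤ _ := by nlinarith [hab]
  have h3 : X ≤ Real.sqrt 6 * ((M : ℝ) * Real.sqrt N) + Real.sqrt (2 * C) * ((N : ℝ) * Q) :=
    le_of_sq_le_sq h2 (by positivity)
  have hx : 0 ≤ Real.sqrt 6 * ((N : ℝ) * Q) + Real.sqrt (2 * C) * ((M : ℝ) * Real.sqrt N) := by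
    positivity
  nlinarith [h3, hx]

/-- `|λ(k)| ≤ 1` (with the junk value `λ 0 = 0`). -/
private theorem calibration_abs_lam_le_one (k : ℕ) : |(ArithmeticFunction.liouville k : ℝ)| ≤ 1 := by
  rcases eq_or_ne k 0 with h | h
  · rw [h]; simp
  · rw [ArithmeticFunction.liouville_apply h]
    push_cast
    rw [abs_pow, abs_neg, abs_one, one_pow]

/-- **`stub_calibrationL1`** — WHAT THE CRUX CONTAINS: `CosetDecorrelation` implies the power-saving,
fixed-residue, level-`1/2` Bombieri–Vinogradov statement
`Σ_{n≤N} |Σ_{m∈(M,2M]} λ(mn+c)| ≤ C'·(M√N + N·M^{3/4−κ/2})` for all `N ≤ 2M`, with `κ = 1/4 − ϑ > 0`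
and `C' = √6 + √(2·max C 0)` (sign-weighted positivity amplifier at `j = ⌊√M⌋+1`, trivial diagonal,
the crux on the off-diagonal pairs). -/
theorem stub_calibrationL1 :
    CosetDecorrelation →
      ∀ c : ℤ, c ≠ 0 → ∃ κ : ℝ, 0 < κ ∧ ∃ C : ℝ, ∀ M N : ℕ, N ≤ 2 * M →
        ∑ n ∈ Finset.Icc 1 N,
            |∑ m ∈ Finset.Ioc M (2 * M), (ArithmeticFunction.liouville (Int.toNat ((m : ℤ) * n + c)) : ℝ)|
          ≤ C * ((M : ℝ) * Real.sqrt N + (N : ℝ) * (M : ℝ) ^ (3 / 4 - κ / 2)) := by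
  intro hCD c hc
  obtain ⟨ϑ, hϑ, C, hT⟩ := hCD c hc
  refine ⟨1 / 4 - ϑ, by linarith, Real.sqrt 6 + Real.sqrt (2 * max C 0), fun M N hN => ?_⟩
  rcases Nat.eq_zero_or_pos N with hN0 | hNpos
  · subst hN0
    simp
  have hM : 1 ≤ M := by omega
  have hMpos : (0 : ℝ) < M := by exact_mod_cast hM
  refine calibration_numerics hM (le_max_right C 0)
    (calibration_raw (fun n m => (ArithmeticFunction.liouville (Int.toNat ((m : ℤ) * n + c)) : ℝ))
      (fun n m => calibration_abs_lam_le_one _) M N (Nat.succ_le_succ (Nat.zero_le _))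
      (mul_nonneg (le_max_right C 0) (Real.rpow_nonneg hMpos.le _)) ?_)
  intro n hn n' hn' hne
  rw [mem_Icc] at hn hn'
  refine (hT M n n' (Nat.sqrt M + 1) hn.1 hn'.1 hne (by omega) (by omega) le_rfl (by omega)).trans ?_
  exact mul_le_mul_of_nonneg_right (le_max_left C 0) (Real.rpow_nonneg hMpos.le _)

/-- TABLE-MEAN COROLLARY: `CosetDecorrelation` implies the power saving
`|Σ_{n≤N} Σ_{m∈(M,2M]} λ(mn+c)| ≤ C'·(M√N + N·M^{3/4−κ/2})` (`N ≤ 2M`) for `λ` summed over the shifted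
multiplication table `{mn + c}` with multiplicity (from `stub_calibrationL1` by the triangle inequality). -/
theorem calibration_tableMean :
    CosetDecorrelation →
      ∀ c : ℤ, c ≠ 0 → ∃ κ : ℝ, 0 < κ ∧ ∃ C : ℝ, ∀ M N : ℕ, N ≤ 2 * M →
        |∑ n ∈ Finset.Icc 1 N, ∑ m ∈ Finset.Ioc M (2 * M),
            (ArithmeticFunction.liouville (Int.toNat ((m : ℤ) * n + c)) : ℝ)|
          ≤ C * ((M : ℝ) * Real.sqrt N + (N : ℝ) * (M : ℝ) ^ (3 / 4 - κ / 2)) := by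
  intro hCD c hc
  obtain ⟨κ, hκ, C, h⟩ := stub_calibrationL1 hCD c hc
  exact ⟨κ, hκ, C, fun M N hN => (abs_sum_le_sum_abs _ _).trans (h M N hN)⟩

end Summit.Parity.GeneralizedHardyLittlewood.Theorems.CosetDecorrelation.FareyLevelMeanCoupling
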